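import Literature.NumberTheory.EllipticCurves.SupersingularDensityDeuringCriterionProofs
import Literature.NumberTheory.EllipticCurves.IsogenyGeomEndRingGaloisProofs
import Literature.NumberTheory.EllipticCurves.IsogenyHomNsmulProofs
import Literature.NumberTheory.EllipticCurves.IsogenyHasCMBaseChangeProofs
import HarnessLib

/-!
# CM torsion core, helpers 7/8: the CM endomorphism of `W` and its character

Helper file (7/8) for stub `stub_CMTorsionCoreOf` ((K†), the CM torsion core) of line
`Sketch` (isotypic–Minkowski reduction) of crux U
`Summit.ABC.ABC.Theses.IsogenyGlueCongruence.EllipticGluingPrimeBound` (stmt-ABC-13919); the stub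
itself is proved in `…EllipticGluingPrimeBoundStubCMTorsionCoreOf`.

* `CMTorsion.false_of_eq_add_prime_mul` — the descent step in the commutative domain
  `End_{ℚ̄}(E)`: with `ψ² = D' < 0`, `|D'|` minimal, `ψ = c + ℓ λ` is impossible for an odd prime
  `ℓ` (the positive definite norm form of Silverman *AEC* III.6.3,
  `exists_int_quadratic_of_mem_geomEndRing`);
* `exists_cm_endomorphism` (registered sub-goal) — for `W/ℚ` with CM: `ψ ∈ End_{ℚ̄}(E)` with
  `ψ² = D' < 0`, a quadratic character `ε` with `ψ(σ Q) = ε(σ) σ ψ(Q)`, and `ψ` non-scalar on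
  `E[ℓ]` for every odd prime `ℓ` (Silverman *AEC* III.4.11 over `ℚ̄`, transported along
  `E(ℚ̄) ≃ E_{ℚ̄}(ℚ̄̄)` in both directions: `exists_isogeny_toAddMonoidHom_eq_conj`,
  `isAlgebraicOn_conj_symm_of_algEquiv`).

All inputs are proved theorems of the tree's Weierstrass-side CM library; no `def`, no named
fact.
-/

noncomputable section

-- `Summit.<Summit>.<Problem>` is the mandated summit-side namespace (CONVENTIONS §2); for the
-- single-conjunct summit `ABC` the two coincide, so the duplicate `ABC.ABC` is deliberate.
set_option linter.dupNamespace false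

namespace Summit.ABC.ABC.Theorems.IsotypicMinkowski

open scoped AddSubgroup Matrix

/-! ## The descent step -/


namespace CMTorsion

/-- **The descent step for the minimal CM endomorphism.** In `R = End_{ℚ̄}(E)` (a commutative
domain of characteristic `0` in which every element satisfies `x² - t x + d = 0` with
`m² + t m n + d n² > 0` for `m + n x ≠ 0`, Silverman *AEC* III.6.3 — the tree's
`exists_int_quadratic_of_mem_geomEndRing`): if `ψ² = D' < 0` with `|D'|` minimal among such, then
`ψ = c + ℓ λ` is impossible for an odd prime `ℓ` — writing `m + n λ = ψ² - D' = 0`, positivity at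
`(m ± 1, n)` gives `2m + t n = 0`, so `n² (4 d - t²) = 0`; `t² = 4 d` forces `2 λ = t` and
`4 D' = (2c + ℓ t)² ≥ 0`, while `n = 0` forces `ℓ ∣ c` and `(ψ/ℓ)² = D'/ℓ²`, against minimality.
[folklore] -/
theorem false_of_eq_add_prime_mul (W : WeierstrassCurve ℚ) [W.IsElliptic] {ℓ : ℕ} (hℓ : ℓ.Prime)
    (hℓ2 : ℓ ≠ 2) (ψ lam : W.geomEndRing) (c D' : ℤ) (hD' : D' < 0)
    (hψψ : ψ * ψ = (D' : W.geomEndRing)) (hrel : ψ = (c : W.geomEndRing) + (ℓ : W.geomEndRing) *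
        lam)
    (hmin : ∀ (x : W.geomEndRing) (D'' : ℤ), D'' < 0 → x * x = (D'' : W.geomEndRing) →
      D'.natAbs ≤ D''.natAbs) : False := by
  haveI := WeierstrassCurve.isDomain_geomEndRing W
  haveI := WeierstrassCurve.charZero_geomEndRing W
  have hcomm : ∀ x y : W.geomEndRing, x * y = y * x := fun x y ↦
    Subtype.ext (WeierstrassCurve.geomEndRing_comm_holds (W := W) x y x.2 y.2)
  letI : CommRing W.geomEndRing := { (inferInstance : Ring W.geomEndRing) with mul_comm := hcomm }
  -- the quadratic relation of `λ` and the positivity of its norm form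
  obtain ⟨t, d, hquad, hpos⟩ := WeierstrassCurve.exists_int_quadratic_of_mem_geomEndRing W lam.2
  have hquad' : lam * lam - (t : W.geomEndRing) * lam + (d : W.geomEndRing) = 0 := by
    apply Subtype.ext
    push_cast
    exact hquad
  have hpos' : ∀ m n : ℤ, (m : W.geomEndRing) + (n : W.geomEndRing) * lam ≠ 0 →
      0 < m ^ 2 + t * m * n + d * n ^ 2 := fun m n h ↦ hpos m n (fun h' ↦ h (Subtype.ext (by
        push_cast; exact h')))
  have hcast : ∀ z : ℤ, (z : W.geomEndRing) = 0 → z = 0 := fun z hz ↦ by exact_mod_cast hz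
  -- `m + n λ = 0` with `m = c² - ℓ² d - D'`, `n = 2 c ℓ + ℓ² t`
  set m : ℤ := c ^ 2 - (ℓ : ℤ) ^ 2 * d - D' with hm_def
  set n : ℤ := 2 * c * ℓ + (ℓ : ℤ) ^ 2 * t with hn_def
  have hmn : (m : W.geomEndRing) + (n : W.geomEndRing) * lam = 0 := by
    have h1 : ψ * ψ - (D' : W.geomEndRing) = 0 := by rw [hψψ, sub_self]
    rw [hrel] at h1
    rw [← h1, hm_def, hn_def]
    push_cast
    linear_combination (-(ℓ : W.geomEndRing) ^ 2) * hquad'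
  -- `m² + t m n + d n² = 0`
  have hE0 : m ^ 2 + t * m * n + d * n ^ 2 = 0 := by
    apply hcast
    push_cast
    linear_combination ((n : W.geomEndRing) ^ 2) * hquad' +
      ((m : W.geomEndRing) - (n : W.geomEndRing) * lam + (t : W.geomEndRing) * (n : W.geomEndRing))
          * hmn
  -- positivity at `(m ± 1, n)` forces `2 m + t n = 0`
  have h2m : 2 * m + t * n = 0 := by
    have hp1 := hpos' (m + 1) n (by
      intro h
      have h' : ((m : W.geomEndRing) + (n : W.geomEndRing) * lam) + 1 = 0 := by
        rw [← h]; push_cast; ring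
      rw [hmn, zero_add] at h'
      exact one_ne_zero h')
    have hm1 := hpos' (m - 1) n (by
      intro h
      have h' : ((m : W.geomEndRing) + (n : W.geomEndRing) * lam) - 1 = 0 := by
        rw [← h]; push_cast; ring
      rw [hmn, zero_sub, neg_eq_zero] at h'
      exact one_ne_zero h')
    nlinarith
  -- hence `n² (4 d - t²) = 0`
  have hn4 : n ^ 2 * (4 * d - t ^ 2) = 0 := by nlinarith
  rcases mul_eq_zero.1 hn4 with hn0 | htd
  · -- `n = 0`: then `m = 0`, `ℓ ∣ c`, and `ψ / ℓ ∈ R` has smaller `|D'|`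
    have hn0' : n = 0 := pow_eq_zero_iff (n := 2) two_ne_zero |>.1 hn0
    have hm0 : m = 0 := by
      apply hcast
      have := hmn
      rwa [hn0', Int.cast_zero, zero_mul, add_zero] at this
    have hℓc : (ℓ : ℤ) ∣ c := by
      have h1 : (ℓ : ℤ) ∣ 2 * c := ⟨-t, by
        rw [hn_def] at hn0'
        have hℓ0 : (ℓ : ℤ) ≠ 0 := by exact_mod_cast hℓ.ne_zero
        have h3 : (2 * c) * (ℓ : ℤ) = ((ℓ : ℤ) * -t) * (ℓ : ℤ) := by linear_combination hn0'
        exact mul_right_cancel₀ hℓ0 h3⟩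
      have hprime : Prime (ℓ : ℤ) := Nat.prime_iff_prime_int.1 hℓ
      rcases hprime.dvd_or_dvd h1 with h2 | h2
      · exfalso
        have : (ℓ : ℤ) ≤ 2 := Int.le_of_dvd two_pos h2
        have := hℓ.two_le
        omega
      · exact h2
    obtain ⟨c', rfl⟩ := hℓc
    -- `ψ = ℓ ψ₁`, `ψ₁ = c' + λ`, `ψ₁² = c'² - d`
    set ψ₁ : W.geomEndRing := (c' : W.geomEndRing) + lam with hψ₁
    have hψ1 : ψ = (ℓ : W.geomEndRing) * ψ₁ := by rw [hrel, hψ₁]; push_cast; ring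
    have hD'eq : D' = (ℓ : ℤ) ^ 2 * (c' ^ 2 - d) := by rw [hm_def] at hm0; linarith
    have hℓ0 : ((ℓ : ℤ) : W.geomEndRing) ≠ 0 := by
      intro h
      have := hcast _ h
      exact hℓ.ne_zero (by exact_mod_cast this)
    have hψ1sq : ψ₁ * ψ₁ = ((c' ^ 2 - d : ℤ) : W.geomEndRing) := by
      have h1 : (ℓ : W.geomEndRing) ^ 2 * (ψ₁ * ψ₁) = (ℓ : W.geomEndRing) ^ 2 *
          ((c' ^ 2 - d : ℤ) : W.geomEndRing) := by
        have h2 : ψ * ψ = (D' : W.geomEndRing) := hψψ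
        rw [hψ1, hD'eq] at h2
        push_cast at h2 ⊢
        linear_combination h2
      have hℓ2' : (ℓ : W.geomEndRing) ^ 2 ≠ 0 := by
        rw [← Int.cast_natCast]; exact pow_ne_zero 2 hℓ0
      exact mul_left_cancel₀ hℓ2' h1
    have hneg : c' ^ 2 - d < 0 := by
      have : (0 : ℤ) < (ℓ : ℤ) ^ 2 := pow_pos (by exact_mod_cast hℓ.pos) 2
      nlinarith
    have hle := hmin ψ₁ (c' ^ 2 - d) hneg hψ1sq
    rw [hD'eq, Int.natAbs_mul, Int.natAbs_pow] at hle
    have h1 : 1 < (ℓ : ℤ).natAbs ^ 2 := by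
      rw [Int.natAbs_natCast]
      exact Nat.one_lt_pow two_ne_zero hℓ.one_lt
    have h2 : 0 < (c' ^ 2 - d).natAbs := Int.natAbs_pos.2 hneg.ne
    nlinarith
  · -- `t² = 4 d`: then `2 λ = t`, `2 ψ ∈ ℤ`, and `4 D' = (2c + ℓ t)² ≥ 0`
    have h2lam : (2 : W.geomEndRing) * lam = (t : W.geomEndRing) := by
      have h1 : ((2 : W.geomEndRing) * lam - (t : W.geomEndRing)) ^ 2 = 0 := by
        have htd' : ((4 * d - t ^ 2 : ℤ) : W.geomEndRing) = 0 := by rw [htd, Int.cast_zero]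
        push_cast at htd'
        linear_combination (4 : W.geomEndRing) * hquad' - htd'
      exact sub_eq_zero.1 (pow_eq_zero_iff two_ne_zero |>.1 h1)
    have h4 : ((4 * D' : ℤ) : W.geomEndRing) = (((2 * c + ℓ * t) ^ 2 : ℤ) : W.geomEndRing) := by
      push_cast
      rw [← hψψ, hrel]
      linear_combination ((4 : W.geomEndRing) * (c : W.geomEndRing) * (ℓ : W.geomEndRing) +
        (ℓ : W.geomEndRing) ^ 2 * ((2 : W.geomEndRing) * lam + (t : W.geomEndRing))) * h2lam
    have h5 : 4 * D' = (2 * c + ℓ * t) ^ 2 := by exact_mod_cast h4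
    nlinarith

/-! ## The CM endomorphism and its character (registered sub-goal of the stub) -/


end CMTorsion

/-- **The CM endomorphism of `W` and its character.** For `W/ℚ` with complex multiplication
there are `ψ ∈ End_{ℚ̄}(E)` with `ψ² = D' < 0` (the tree's `exists_sq_eq_intCast_of_hasCM`, taken
with
`|D'|` minimal), a character `ε : Γ_ℚ → {±1}` with `ψ(σ Q) = ε(σ) σ ψ(Q)` (`End_{ℚ̄}(E)` is a
`Γ_ℚ`-stable commutative domain: `conj_mem_geomEndRing`, so `σψσ⁻¹ = ± ψ`), and `ψ` is not a scalar
on `E[ℓ]` for any odd prime `ℓ`: otherwise `ψ - c` kills `E[ℓ]`, and transported to `E_{ℚ̄}` over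
`ℚ̄` (`exists_isogeny_toAddMonoidHom_eq_conj`) it factors through `[ℓ]` (Silverman *AEC* III.4.11,
`Isogeny.exists_eq_comp_nsmul_of_geomTorsion_le_ker_holds`), the factor being algebraic on `E(ℚ̄)`
(`isAlgebraicOn_conj_symm_of_algEquiv`): `ψ = c + ℓ λ` in `End_{ℚ̄}(E)`, excluded by
`false_of_eq_add_prime_mul`. [folklore] -/
theorem exists_cm_endomorphism (W : WeierstrassCurve ℚ) [W.IsElliptic] (hCM : W.HasCM) :
    ∃ (ψ : AddMonoid.End W.geomPoints) (D' : ℤ) (ε : Field.absoluteGaloisGroup ℚ →* ℤˣ),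
      D' < 0 ∧ (∀ Q, ψ (ψ Q) = D' • Q) ∧
      (∀ (σ : Field.absoluteGaloisGroup ℚ) (Q : W.geomPoints),
        ψ (σ • Q) = ((ε σ : ℤˣ) : ℤ) • σ • ψ Q) ∧
      ∀ ℓ : ℕ, ℓ.Prime → ℓ ≠ 2 → ∀ c : ℤ, ∃ Q ∈ W.geomTorsion ℓ, ψ Q ≠ c • Q := by
  classical
  -- a CM endomorphism `ψ`, `ψ² = D' < 0`, with `|D'|` minimal
  have hex : ∃ m : ℕ, ∃ ψ ∈ W.geomEndRing, ∃ D' : ℤ, D' < 0 ∧ D'.natAbs = m ∧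
      ψ * ψ = (D' : AddMonoid.End W.geomPoints) := by
    obtain ⟨ψ, hψ, D', hD', hψψ⟩ := WeierstrassCurve.exists_sq_eq_intCast_of_hasCM W hCM
    exact ⟨D'.natAbs, ψ, hψ, D', hD', rfl, hψψ⟩
  obtain ⟨ψ, hψ, D', hD', hm₀, hψψ⟩ := Nat.find_spec hex
  have hmin : ∀ ψ' ∈ W.geomEndRing, ∀ D'' : ℤ, D'' < 0 →
      ψ' * ψ' = (D'' : AddMonoid.End W.geomPoints) → D'.natAbs ≤ D''.natAbs :=
    fun ψ' hψ' D'' hD'' h ↦ by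
      rw [hm₀]; exact Nat.find_min' hex ⟨ψ', hψ', D'', hD'', rfl, h⟩
  -- pointwise bookkeeping in `AddMonoid.End E(ℚ̄)`
  have hmul : ∀ (f g : AddMonoid.End W.geomPoints) (P : W.geomPoints), (f * g) P = f (g P) :=
    fun _ _ _ ↦ rfl
  have hsub : ∀ (f g : AddMonoid.End W.geomPoints) (P : W.geomPoints), (f - g) P = f P - g P :=
    fun _ _ _ ↦ rfl
  have hadd : ∀ (f g : AddMonoid.End W.geomPoints) (P : W.geomPoints), (f + g) P = f P + g P :=
    fun _ _ _ ↦ rfl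
  have hneg : ∀ (f : AddMonoid.End W.geomPoints) (P : W.geomPoints), (-f) P = -f P :=
    fun _ _ ↦ rfl
  have hσz : ∀ (σ : Field.absoluteGaloisGroup ℚ) (n : ℤ) (P : W.geomPoints), σ • (n • P) = n • σ •
      P :=
    fun σ n P ↦ map_zsmul (DistribSMul.toAddMonoidHom W.geomPoints σ) n P
  -- the ring `R = End_{ℚ̄}(E)`: a commutative domain of characteristic `0`
  haveI := WeierstrassCurve.isDomain_geomEndRing W
  haveI := WeierstrassCurve.charZero_geomEndRing W
  have hcomm : ∀ x y : W.geomEndRing, x * y = y * x := fun x y ↦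
    Subtype.ext (WeierstrassCurve.geomEndRing_comm_holds (W := W) x y x.2 y.2)
  have hψψ' : (⟨ψ, hψ⟩ : W.geomEndRing) * ⟨ψ, hψ⟩ = (D' : W.geomEndRing) := Subtype.ext (by
    push_cast; exact hψψ)
  have hψψQ : ∀ Q, ψ (ψ Q) = D' • Q := fun Q ↦ by
    have h := congrArg (fun f : AddMonoid.End W.geomPoints ↦ f Q) hψψ
    simp only [hmul, AddMonoid.End.intCast_apply] at h
    exact h
  have hψ0 : ψ ≠ 0 := fun h0 ↦ by
    have h1 : ((D' : ℤ) : W.geomEndRing) = 0 := by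
      rw [← hψψ']
      apply Subtype.ext
      change ψ * ψ = 0
      rw [h0, mul_zero]
    exact hD'.ne (by exact_mod_cast h1)
  -- the character `ε`: `σ ψ σ⁻¹ = ± ψ`
  have hsign : ∀ σ : Field.absoluteGaloisGroup ℚ, ∃ s : ℤˣ, ∀ Q : W.geomPoints,
      ψ (σ • Q) = ((s : ℤˣ) : ℤ) • σ • ψ Q := by
    intro σ
    set ψσ : AddMonoid.End W.geomPoints :=
      DistribMulAction.toAddMonoidEnd (Field.absoluteGaloisGroup ℚ) W.geomPoints σ * ψ *
        DistribMulAction.toAddMonoidEnd (Field.absoluteGaloisGroup ℚ) W.geomPoints σ⁻¹ with hψσ_def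
    have hψσmem : ψσ ∈ W.geomEndRing := WeierstrassCurve.conj_mem_geomEndRing W hψ σ
    have hψσ_apply : ∀ P, ψσ P = σ • ψ (σ⁻¹ • P) := fun P ↦ rfl
    have hψσsq' : ψσ * ψσ = (D' : AddMonoid.End W.geomPoints) := by
      refine DFunLike.ext _ _ fun P ↦ ?_
      rw [hmul, hψσ_apply, hψσ_apply, inv_smul_smul, hψψQ, hσz,
        smul_inv_smul, AddMonoid.End.intCast_apply]
    have hψσsq : (⟨ψσ, hψσmem⟩ : W.geomEndRing) * ⟨ψσ, hψσmem⟩ = (D' : W.geomEndRing) :=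
      Subtype.ext (by push_cast; exact hψσsq')
    have hprod : ((⟨ψσ, hψσmem⟩ : W.geomEndRing) - ⟨ψ, hψ⟩) * (⟨ψσ, hψσmem⟩ + ⟨ψ, hψ⟩) = 0 := by
      rw [sub_mul, mul_add, mul_add, hψσsq, hψψ', hcomm ⟨ψ, hψ⟩ ⟨ψσ, hψσmem⟩]
      abel
    rcases mul_eq_zero.1 hprod with h | h
    · refine ⟨1, fun Q ↦ ?_⟩
      have h' : ψσ = ψ := congrArg Subtype.val (sub_eq_zero.1 h)
      have h'' := congrArg (fun f : AddMonoid.End W.geomPoints ↦ f (σ • Q)) h'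
      simp only [hψσ_apply, inv_smul_smul] at h''
      rw [← h'', Units.val_one, one_zsmul]
    · refine ⟨-1, fun Q ↦ ?_⟩
      have h' : ψσ = -ψ := congrArg Subtype.val (eq_neg_of_add_eq_zero_left h)
      have h'' := congrArg (fun f : AddMonoid.End W.geomPoints ↦ f (σ • Q)) h'
      simp only [hψσ_apply, inv_smul_smul, hneg] at h''
      rw [Units.val_neg, Units.val_one, neg_one_zsmul, ← neg_eq_iff_eq_neg.2 h'']
  -- uniqueness of the sign (`ψ ≠ 0`, `E(ℚ̄)` is `2`-divisible)
  have huniq : ∀ (σ : Field.absoluteGaloisGroup ℚ) (s s' : ℤˣ),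
      (∀ Q : W.geomPoints, ψ (σ • Q) = ((s : ℤˣ) : ℤ) • σ • ψ Q) →
      (∀ Q : W.geomPoints, ψ (σ • Q) = ((s' : ℤˣ) : ℤ) • σ • ψ Q) → s = s' := by
    intro σ s s' hs hs'
    by_contra hne
    have h2 : ((s : ℤˣ) : ℤ) - ((s' : ℤˣ) : ℤ) = 2 ∨ ((s : ℤˣ) : ℤ) - ((s' : ℤˣ) : ℤ) = -2 := by
      rcases Int.units_eq_one_or s with rfl | rfl <;> rcases Int.units_eq_one_or s' with rfl | rfl
      · exact absurd rfl hne
      · exact Or.inl (by norm_num)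
      · exact Or.inr (by norm_num)
      · exact absurd rfl hne
    have hzero : ∀ Q : W.geomPoints, (2 : ℤ) • ψ Q = 0 := fun Q ↦ by
      have h3 : (((s : ℤˣ) : ℤ) - ((s' : ℤˣ) : ℤ)) • σ • ψ Q = 0 := by
        rw [sub_smul, ← hs Q, ← hs' Q, sub_self]
      have h4 : (2 : ℤ) • σ • ψ Q = 0 := by
        rcases h2 with h2 | h2
        · rwa [h2] at h3
        · rw [h2, neg_smul, neg_eq_zero] at h3; exact h3
      have h5 := congrArg (fun P ↦ σ⁻¹ • P) h4
      simp only [hσz, inv_smul_smul, smul_zero] at h5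
      exact h5
    apply hψ0
    refine AddMonoidHom.ext fun Q ↦ ?_
    obtain ⟨Q', hQ'⟩ := WeierstrassCurve.nsmul_geomPoints_surjective W (n := 2) two_ne_zero Q
    change 2 • Q' = Q at hQ'
    rw [← hQ', map_nsmul, ← natCast_zsmul]
    exact hzero Q'
  let ε : Field.absoluteGaloisGroup ℚ →* ℤˣ := MonoidHom.mk' (fun σ ↦ Classical.choose (hsign σ))
    (fun σ τ ↦ by
      apply huniq (σ * τ) _ _ (Classical.choose_spec (hsign (σ * τ)))
      intro Q
      rw [mul_smul, mul_smul, Classical.choose_spec (hsign σ), Classical.choose_spec (hsign τ), hσz,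
        smul_smul, Units.val_mul])
  have hε : ∀ (σ : Field.absoluteGaloisGroup ℚ) (Q : W.geomPoints),
      ψ (σ • Q) = ((ε σ : ℤˣ) : ℤ) • σ • ψ Q := fun σ ↦ Classical.choose_spec (hsign σ)
  refine ⟨ψ, D', ε, hD', hψψQ, hε, ?_⟩
  -- non-scalarity modulo every odd prime
  intro ℓ hℓ hℓ2 c
  by_contra hcon
  push Not at hcon
  -- `θ = ψ - c` is a non-zero algebraic endomorphism killing `E[ℓ]`
  set θ : AddMonoid.End W.geomPoints := ψ - (c : AddMonoid.End W.geomPoints) with hθ_def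
  have hθmem : θ ∈ W.geomEndRing := W.geomEndRing.sub_mem hψ (intCast_mem W.geomEndRing c)
  have hθ_apply : ∀ Q, θ Q = ψ Q - c • Q := fun Q ↦ by
    rw [hθ_def, hsub, AddMonoid.End.intCast_apply]
  have hθ0 : θ ≠ 0 := fun h0 ↦ by
    have h1 : ψ = (c : AddMonoid.End W.geomPoints) := sub_eq_zero.1 h0
    have h2 : ((c * c : ℤ) : W.geomEndRing) = (D' : W.geomEndRing) := by
      rw [← hψψ']
      apply Subtype.ext
      push_cast
      rw [h1]
    have h3 : c * c = D' := by exact_mod_cast h2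
    nlinarith
  have halg : WeierstrassCurve.IsAlgebraicOn W W θ :=
    ((WeierstrassCurve.mem_geomEndRing_iff_holds (W := W) θ).1 hθmem).resolve_left hθ0
  -- transport to `E_{ℚ̄}` over `ℚ̄`, where Silverman III.4.11 is available
  have hinj := WeierstrassCurve.Affine.Point.map_injective (W' := W)
    (Algebra.ofId (AlgebraicClosure ℚ) (AlgebraicClosure (AlgebraicClosure ℚ)))
  let β : W.geomPoints ≃+ (W.baseChange (AlgebraicClosure ℚ)).geomPoints :=
    AddEquiv.ofBijective _ ⟨hinj, WeierstrassCurve.map_ofId_algebraicClosure_surjective⟩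
  have hβ : ∀ P, β P = WeierstrassCurve.Affine.Point.map (W' := W)
      (Algebra.ofId (AlgebraicClosure ℚ) (AlgebraicClosure (AlgebraicClosure ℚ))) P := fun _ ↦ rfl
  obtain ⟨φ', hφ'⟩ := WeierstrassCurve.exists_isogeny_toAddMonoidHom_eq_conj β hβ halg
  have hφ'_apply : ∀ P, φ' P = β (θ (β.symm P)) := fun P ↦ by
    change φ'.toAddMonoidHom P = _
    rw [hφ']
    rfl
  have hkill : ∀ P ∈ WeierstrassCurve.geomTorsion (W.baseChange (AlgebraicClosure ℚ)) ℓ,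
      φ' P = 0 := by
    intro P hP
    rw [hφ'_apply]
    have hP' : β.symm P ∈ W.geomTorsion ℓ := by
      simp only [Submodule.mem_toAddSubgroup, Submodule.mem_torsionBy_iff] at hP ⊢
      rw [← map_zsmul, hP, map_zero]
    rw [hθ_apply, hcon _ hP', sub_self]
    exact map_zero β
  have hℓK : ((ℓ : ℕ) : AlgebraicClosure ℚ) ≠ 0 := by exact_mod_cast hℓ.ne_zero
  obtain ⟨lam, hlam⟩ :=
    WeierstrassCurve.Isogeny.exists_eq_comp_nsmul_of_geomTorsion_le_ker_holds
      (W.baseChange (AlgebraicClosure ℚ)) (W.baseChange (AlgebraicClosure ℚ)) hℓK φ' hkill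
  -- back to `E(ℚ̄)`: `λ = β⁻¹ ∘ lam ∘ β` is algebraic
  have hbij : Function.Bijective (algebraMap (AlgebraicClosure ℚ)
      (AlgebraicClosure (AlgebraicClosure ℚ))) :=
    IsAlgClosed.algebraMap_bijective_of_isIntegral
  let ι₀ : AlgebraicClosure ℚ ≃ₐ[ℚ] AlgebraicClosure (AlgebraicClosure ℚ) :=
    AlgEquiv.ofBijective (IsScalarTower.toAlgHom ℚ (AlgebraicClosure ℚ)
      (AlgebraicClosure (AlgebraicClosure ℚ))) hbij
  have hβ' : ∀ P, β P = WeierstrassCurve.Affine.Point.map (W' := W)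
      (ι₀ : AlgebraicClosure ℚ →ₐ[ℚ] AlgebraicClosure (AlgebraicClosure ℚ)) P := fun P ↦ by
    rcases P with _ | ⟨x, y, h⟩ <;> rfl
  set lamW : AddMonoid.End W.geomPoints :=
    (β.symm.toAddMonoidHom.comp lam.toAddMonoidHom).comp β.toAddMonoidHom with hlamW_def
  have hlamW_apply : ∀ Q, lamW Q = β.symm (lam (β Q)) := fun _ ↦ rfl
  have hlamWalg : WeierstrassCurve.IsAlgebraicOn W W lamW :=
    WeierstrassCurve.isAlgebraicOn_conj_symm_of_algEquiv ι₀ β hβ' lam.isAlgebraic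
  have hlamWmem : lamW ∈ W.geomEndRing := Subring.subset_closure hlamWalg
  -- `ψ = c + ℓ λ`
  have hrelQ : ∀ Q, ψ Q = c • Q + (ℓ : ℤ) • lamW Q := fun Q ↦ by
    have h1 : θ Q = β.symm (φ' (β Q)) := by
      rw [hφ'_apply, AddEquiv.symm_apply_apply, AddEquiv.symm_apply_apply]
    have h2 : φ' (β Q) = lam (β (ℓ • Q)) := by rw [map_nsmul]; exact hlam (β Q)
    rw [h2, ← hlamW_apply, map_nsmul, hθ_apply] at h1
    rw [natCast_zsmul, ← h1, add_sub_cancel]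
  have hrel : (⟨ψ, hψ⟩ : W.geomEndRing) =
      (c : W.geomEndRing) + (ℓ : W.geomEndRing) * ⟨lamW, hlamWmem⟩ := by
    apply Subtype.ext
    push_cast
    refine DFunLike.ext _ _ fun Q ↦ ?_
    rw [hrelQ, hadd, AddMonoid.End.intCast_apply, hmul, AddMonoid.End.natCast_apply, natCast_zsmul]
  exact CMTorsion.false_of_eq_add_prime_mul W hℓ hℓ2 ⟨ψ, hψ⟩ ⟨lamW, hlamWmem⟩ c D' hD' hψψ' hrel
    (fun x D'' hD'' hx ↦ hmin x x.2 D'' hD'' (by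
      have h := congrArg Subtype.val hx
      push_cast at h
      exact h))

end Summit.ABC.ABC.Theorems.IsotypicMinkowski

end
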